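import Summits.KontsevichZagierPeriods.KontsevichZagierPeriods.Theorems.SymplecticScissorsVolumeFormOffPlaneScissors
import Summits.KontsevichZagierPeriods.KontsevichZagierPeriods.Theorems.SymplecticScissorsVolumeFormOffPlanePairsOfDecomposition
import Summits.KontsevichZagierPeriods.KontsevichZagierPeriods.Theorems.SymplecticScissorsVolumeFormOffPlaneTorsionClosure

/-!
# `VolumeFormOffPlane` (stmt-KontsevichZagierPeriods-14935) — line `Sketch`:
COMMENSURABLE PAIRS (the signed-scissors layer over a single reference representation)

The abstract v6 layer of the line (`stub_scissors`, `stub_torsionClosure`,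
`stub_pairsOfDecomposition`) does not know about tori or logarithms. Its simplest instance, recorded
here for the sibling lines of the frame `VolumeForm` (stmt-3814; e.g. the rational-polytope /
ruled-stack sectors in `ℝ³`) and for every dimension:

* `commensurablePairs` — fix ANY integral representation `u` with `u.value ≠ 0` (a unit cube, a
  point, `[π]`, …). Two integrand-`1` representations `r`, `r'` of one dimension whose domains
  are, almost everywhere, `ℤ`-combinations of indicators of domains of integrand-`1`
  representations `ρ i`, each of which (where its weight is non-zero) is RATIONALLY COMMENSURABLE
  with `u` modulo the moves — `d • [ρ i] − w • [u] ∈ KZ.relations` for some `d ≥ 1`, `w ∈ ℤ` —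
  and whose values agree, are KZ-equivalent.

So on every class of solids whose formal classes are rational multiples of one class, volume
decides KZ-equivalence; Hilbert's third problem has no obstruction in the Kontsevich–Zagier
calculus on such a class as soon as the commensurability certificates are produced (for rational
polytopes: affine rule-(2) moves with rational Jacobian plus integrand additivity; not done here).

Sources: Kontsevich–Zagier 2001, §1.2 (the moves, soundness); folklore.
-/

noncomputable section

open MeasureTheory Set
open Literature.NumberTheory.Transcendental

namespace Summit.KontsevichZagierPeriods.SymplecticScissors.LogPolytope

/-- **The `ℤ`-weighted property of a single reference representation.** If `u.value ≠ 0`, a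
weighted family of copies of `u` with total weighted value `0` has total weight `0`, so its
weighted formal sum vanishes. [folklore] -/
theorem cmp_weighted_single {N : ℕ} (u : KZ.IntegralRep N) (hu : u.value ≠ 0) :
    ∀ (k : ℕ) (σ : Fin k → KZ.IntegralRep N) (w : Fin k → ℤ),
      (∀ j, w j ≠ 0 → σ j = u) → ∑ j, (w j : ℝ) * (σ j).value = 0 →
      ∑ j, w j • KZ.of (σ j) ∈ KZ.relations := by
  intro k σ w hσ hval
  classical
  have hterm : ∀ j, w j • KZ.of (σ j) = w j • KZ.of u := by
    intro j
    by_cases hj : w j = 0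
    · simp [hj]
    · rw [hσ j hj]
  have hvterm : ∀ j, (w j : ℝ) * (σ j).value = (w j : ℝ) * u.value := by
    intro j
    by_cases hj : w j = 0
    · simp [hj]
    · rw [hσ j hj]
  simp only [hvterm] at hval
  rw [← Finset.sum_mul, mul_eq_zero] at hval
  have hsum : ∑ j, (w j : ℝ) = 0 := hval.resolve_right hu
  have hsumZ : ∑ j, w j = 0 := by exact_mod_cast hsum
  simp only [hterm]
  rw [← Finset.sum_smul, hsumZ, zero_smul]
  exact KZ.relations.zero_mem

/-- **COMMENSURABLE PAIRS.** Fix an integral representation `u` with `u.value ≠ 0`. Two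
integrand-`1` representations of one dimension whose domains are, almost everywhere,
`ℤ`-combinations of indicators of domains of integrand-`1` representations `ρ i` — each, where
its weight is non-zero, rationally commensurable with `u` modulo the moves
(`d • [ρ i] − w • [u] ∈ KZ.relations`, `d ≠ 0`) — and whose values agree are KZ-equivalent:
`stub_pairsOfDecomposition` fed with `stub_scissors` and with `stub_torsionClosure` over the
one-element class `{u}` (`cmp_weighted_single`). [folklore] -/
theorem commensurablePairs :
    ∀ (N : ℕ) (u : KZ.IntegralRep N), u.value ≠ 0 →
      ∀ (r r' : KZ.IntegralRep N) (k k' : ℕ) (ρ : Fin k → KZ.IntegralRep N)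
        (ρ' : Fin k' → KZ.IntegralRep N) (c : Fin k → ℤ) (c' : Fin k' → ℤ),
      (∀ x ∈ r.domain, r.integrand x = 1) → (∀ x ∈ r'.domain, r'.integrand x = 1) →
      (∀ i, ∀ x ∈ (ρ i).domain, (ρ i).integrand x = 1) →
      (∀ i, ∀ x ∈ (ρ' i).domain, (ρ' i).integrand x = 1) →
      (∀ i, c i ≠ 0 → ∃ (d : ℕ) (w : ℤ), d ≠ 0 ∧ d • KZ.of (ρ i) - w • KZ.of u ∈ KZ.relations) →
      (∀ i, c' i ≠ 0 → ∃ (d : ℕ) (w : ℤ), d ≠ 0 ∧ d • KZ.of (ρ' i) - w • KZ.of u ∈ KZ.relations) →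
      (∀ᵐ x : Fin N → ℝ, r.domain.indicator (fun _ => (1 : ℝ)) x =
        ∑ i, (c i : ℝ) * (ρ i).domain.indicator (fun _ => (1 : ℝ)) x) →
      (∀ᵐ x : Fin N → ℝ, r'.domain.indicator (fun _ => (1 : ℝ)) x =
        ∑ i, (c' i : ℝ) * (ρ' i).domain.indicator (fun _ => (1 : ℝ)) x) →
      r.value = r'.value → KZ.Equivalent r r' := by
  intro N u hu r r' k k' ρ ρ' c c' hr hr' hρ hρ' hc hc' hdec hdec' hval
  -- the weighted property of the commensurable class (torsion closure of `{u}`)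
  have hW := stub_torsionClosure N (fun σ => σ = u) (cmp_weighted_single u hu)
  -- certificates in the shape of `stub_torsionClosure`
  have hcert : ∀ {K : ℕ} (τ : Fin K → KZ.IntegralRep N) (e : Fin K → ℤ),
      (∀ i, e i ≠ 0 → ∃ (d : ℕ) (w : ℤ), d ≠ 0 ∧ d • KZ.of (τ i) - w • KZ.of u ∈ KZ.relations) →
      ∀ i, e i ≠ 0 → ∃ (d l : ℕ) (σ : Fin l → KZ.IntegralRep N) (w : Fin l → ℤ), d ≠ 0 ∧
        (∀ j, w j ≠ 0 → σ j = u) ∧ d • KZ.of (τ i) - ∑ j, w j • KZ.of (σ j) ∈ KZ.relations := by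
    intro K τ e he i hi
    obtain ⟨d, w, hd, hrel⟩ := he i hi
    exact ⟨d, 1, fun _ => u, fun _ => w, hd, fun _ _ => rfl, by simpa using hrel⟩
  refine stub_pairsOfDecomposition N
    (fun τ => ∃ (d l : ℕ) (σ : Fin l → KZ.IntegralRep N) (w : Fin l → ℤ), d ≠ 0 ∧
      (∀ j, w j ≠ 0 → σ j = u) ∧ d • KZ.of τ - ∑ j, w j • KZ.of (σ j) ∈ KZ.relations)
    (fun _ => False) (stub_scissors N) ?_
    r r' k 0 k' 0 ρ (fun ν => ν.elim0) ρ' (fun ν => ν.elim0) c (fun ν => ν.elim0)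
    c' (fun ν => ν.elim0) hr hr' hρ (fun ν => ν.elim0) hρ' (fun ν => ν.elim0) (hcert ρ c hc)
    (fun ν => ν.elim0) (hcert ρ' c' hc') (fun ν => ν.elim0) (by simpa using hdec)
    (by simpa using hdec') hval
  intro K M ρB ρS cB cS hB hS hv
  have hcS : ∀ ν, cS ν = 0 := fun ν => by_contra fun h => hS ν h
  simp only [hcS, Int.cast_zero, zero_mul, Finset.sum_const_zero, add_zero, zero_smul] at hv ⊢
  exact hW K ρB cB hB hv

end Summit.KontsevichZagierPeriods.SymplecticScissors.LogPolytope

end
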